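import Literature.NumberTheory.EllipticCurves.KellerYin2024.AnticyclotomicLocalEulerFactors
import Literature.NumberTheory.EllipticCurves.BSDQuadraticDescentProofs
import HarnessLib

/-!
# The typed local `λ`-terms of item 24040 `EisensteinCongruenceCoreAtThree` VANISH at the places above `p`
# (F-CHL-A5-2, kernel half: the additive `27 ∣ N` frame keeps the printed tame factor set)

Route `CumulativeHeegnerLeopoldt`, crux K2-odd stmt-23970, line `birth` v6, stub AN = crux item stmt-24040
(lead `bsd-line-chl-p1` g10; `--supports stmt-BirchSwinnertonDyer-24040`).

Item 24040 (the additive twin of Castella–Grossi–Lee–Skinner 2022 Thm. 2.2.2 with (2.16)) sums Keller–Yin's local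
`λ`-invariants `λ(𝒫_w(f))` (`KellerYin2024.curveLocalLambda`) and `λ(𝒫_w(θ))` (`KellerYin2024.charLocalLambda`) over
`Sf = {w : N ∈ w}` — ALL places of `K` dividing the conductor, hence, on the Leopoldt cell (`27 ∣ N`), also over the two
places `𝔭, 𝔭'` of `K` above `p = 3`, where the printed Euler factor `𝓔_{φ,ψ} = ∏_{ℓ∣N₀N₋} 𝒫_w(φ) · ∏_{ℓ∣N₀N₊} 𝒫_w(ψ)`
(CGLS Thm. 2.2.1, `p ∤ N`) has NO factor (`𝒫_w` is only defined at `w ∤ p`). This file checks in the kernel that the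
typed terms at `w ∣ p` are ZERO for every curve and every character, so the typed symmetric sum over `{w ∣ N}` equals
the printed tame sum over `{w ∣ N, w ∤ p}`:

* `absNorm_eq_prime_pow_of_mem` — `p ∈ w ⇒ Nw = p^k` with `k ≥ 1`; hence `(Nw : ZMod p) = 0` and `‖(Nw : ℚ̄_p)‖ < 1`;
* `curveLocalLambda_eq_zero_of_mem` — `λ(𝒫_w(f)) = [Γ:Γ_w] · mult_{X = (Nw)⁻¹}(P̃_w) = 0`: the tree evaluates the
  root at Mathlib's junk inverse `(0 : ZMod p)⁻¹ = 0`, and `P̃_w(0) = 1` (`coeff_zero_localPolynomialAt`);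
* `norm_eq_one_of_hasFrobCharpolyAt` — for a character `θ : Γ_K → GL₁(𝒪)`, a Frobenius eigenvalue `a`
  (`θ.HasFrobCharpolyAt w (X − C a)`) is the entry of an invertible `1 × 1` matrix, a unit of `𝒪`, so `‖a‖ = 1`;
* `not_frobActsAsNormAt_of_mem`, `charLocalLambda_eq_zero_of_mem` — hence `‖a − Nw‖ < 1` is impossible at `w ∣ p`
  (ultrametric inequality), i.e. `θ(Frob_w) ≢ Nw`, and `λ(𝒫_w(θ)) = 0`;
* `sum_curveLocalLambda_eq_sum_filter`, `sum_charLocalLambda_eq_sum_filter` — the sums over any finite `Sf` equal the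
  sums over `Sf.filter (p ∉ ·)`.

Elementary and unconditional (no named fact); nothing here asserts the Eisenstein congruence itself. BSD is not proved
by any of this.

References: [CastellaGrossiLeeSkinner2022] Invent. Math. 227 (2022) Thm. 2.2.1 (`𝓔_{φ,ψ}`), Thm. 2.2.2, (2.16);
[KellerYin2024] arXiv:2402.12781v2 Lemma 1.1.1, §1.5; [GreenbergVatsal2000] Prop. (2.4).
-/

set_option autoImplicit false
set_option linter.dupNamespace false -- the summit namespace `…BirchSwinnertonDyer.BirchSwinnertonDyer.Theorems` (D-0017) trips it

noncomputable section

open scoped Classical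

open Polynomial NumberField IsDedekindDomain Field
  Literature.NumberTheory.EllipticCurves Literature.NumberTheory.EllipticCurves.KellerYin2024
  Literature.NumberTheory.GaloisRepresentations

namespace Summit.BirchSwinnertonDyer.BirchSwinnertonDyer.Theorems.EisensteinCongruenceCoreAtThreeLocalTermsAtP

variable {K : Type} [Field K] [NumberField K] {p : ℕ} [hp : Fact p.Prime]

/-! ## §1 The norm of a place above `p` -/

/-- A finite place `w` of `K` containing `p` has absolute norm `Nw = p^k` for some `k ≥ 1`.
[cite: NeukirchANT1999, Ch. I §8 (fundamental identity)] -/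
theorem absNorm_eq_prime_pow_of_mem (w : HeightOneSpectrum (𝓞 K)) (hw : ((p : ℕ) : 𝓞 K) ∈ w.asIdeal) :
    ∃ k : ℕ, 0 < k ∧ w.asIdeal.absNorm = p ^ k := by
  have hle : Ideal.span {((p : ℕ) : 𝓞 K)} ≤ w.asIdeal := (Ideal.span_singleton_le_iff_mem _).2 hw
  have hdvd : w.asIdeal.absNorm ∣ (Ideal.span {((p : ℕ) : 𝓞 K)}).absNorm := Ideal.absNorm_dvd_absNorm_of_le hle
  have hsp : (Ideal.span {((p : ℕ) : 𝓞 K)}).absNorm = p ^ Module.finrank ℤ (𝓞 K) := by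
    rw [Ideal.absNorm_span_singleton]
    have : ((p : ℕ) : 𝓞 K) = algebraMap ℤ (𝓞 K) (p : ℤ) := by simp
    rw [this, Algebra.norm_algebraMap, Int.natAbs_pow, Int.natAbs_natCast]
  rw [hsp] at hdvd
  obtain ⟨k, -, hk⟩ := (Nat.dvd_prime_pow hp.out).1 hdvd
  refine ⟨k, Nat.pos_of_ne_zero ?_, hk⟩
  rintro rfl
  rw [pow_zero, Ideal.absNorm_eq_one_iff] at hk
  exact w.isPrime.ne_top hk

/-- At a place `w ∋ p`: `(Nw : ZMod p) = 0`. [cite: NeukirchANT1999, Ch. I §8] -/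
theorem absNorm_cast_zmod_eq_zero (w : HeightOneSpectrum (𝓞 K)) (hw : ((p : ℕ) : 𝓞 K) ∈ w.asIdeal) :
    ((w.asIdeal.absNorm : ℕ) : ZMod p) = 0 := by
  obtain ⟨k, hk, h⟩ := absNorm_eq_prime_pow_of_mem w hw
  rw [h, Nat.cast_pow, ZMod.natCast_self, zero_pow hk.ne']

/-- At a place `w ∋ p`: `‖(Nw : ℚ̄_p)‖ < 1`. [cite: NeukirchANT1999, Ch. II §4 (the p-adic absolute value)] -/
theorem norm_absNorm_lt_one (w : HeightOneSpectrum (𝓞 K)) (hw : ((p : ℕ) : 𝓞 K) ∈ w.asIdeal) :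
    ‖((w.asIdeal.absNorm : ℕ) : PadicAlgCl p)‖ < 1 := by
  obtain ⟨k, hk, h⟩ := absNorm_eq_prime_pow_of_mem w hw
  have hnp : ‖((p : ℕ) : PadicAlgCl p)‖ < 1 := by
    rw [← map_natCast (algebraMap ℚ_[p] (PadicAlgCl p)) p]
    change ‖(((p : ℕ) : ℚ_[p]) : PadicAlgCl p)‖ < 1
    rw [PadicAlgCl.norm_extends, Padic.norm_p]
    exact inv_lt_one_of_one_lt₀ (by exact_mod_cast hp.out.one_lt)
  rw [h, Nat.cast_pow, norm_pow]
  exact pow_lt_one₀ (norm_nonneg _) hnp hk.ne'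

/-! ## §2 The curve term `λ(𝒫_w(f))` vanishes at `w ∣ p` -/

/-- **`λ(𝒫_w(f)) = 0` at every place `w ∋ p`**, for every Weierstrass curve over `K` and every `ℤ_p`-tower `κ`: the
reduced Euler factor `P̃_w` has constant term `1`, and the tree reads the root at `(Nw)⁻¹ = 0⁻¹ = 0 ∈ 𝔽_p`.
(In print `𝒫_w(f)` is only formed at `w ∤ p`; this is the typed term's value there.)
[cite: KellerYin2024, §1.5 (arXiv:2402.12781v2 TeX L1337–1341)] [cite: GreenbergVatsal2000, §2 Prop. (2.4) (p. 22)] -/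
theorem curveLocalLambda_eq_zero_of_mem (κ : ZpExtension K p) (W : WeierstrassCurve K)
    {w : HeightOneSpectrum (𝓞 K)} (hw : ((p : ℕ) : 𝓞 K) ∈ w.asIdeal) : curveLocalLambda κ W w = 0 := by
  apply curveLocalLambda_eq_zero_of_not_isRoot
  rw [absNorm_cast_zmod_eq_zero w hw, inv_zero, Polynomial.IsRoot.def, ← Polynomial.coeff_zero_eq_eval_zero,
    GreenbergVatsal2000.eulerFactorModP, Polynomial.coeff_map, WeierstrassCurve.coeff_zero_localPolynomialAt, map_one]
  exact one_ne_zero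

/-- The sum of the curve terms over any finite set of places equals the sum over its places prime to `p`.
[cite: CastellaGrossiLeeSkinner2022, Thm. 2.2.2 (the sum over w ∈ S)] -/
theorem sum_curveLocalLambda_eq_sum_filter (κ : ZpExtension K p) (W : WeierstrassCurve K)
    (Sf : Finset (HeightOneSpectrum (𝓞 K))) :
    ∑ w ∈ Sf, curveLocalLambda κ W w = ∑ w ∈ Sf.filter (fun w ↦ ((p : ℕ) : 𝓞 K) ∉ w.asIdeal), curveLocalLambda κ W w := by
  rw [Finset.sum_filter]
  refine Finset.sum_congr rfl fun w _ ↦ ?_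
  split_ifs with h
  · exact curveLocalLambda_eq_zero_of_mem κ W h
  · rfl

/-! ## §3 The character term `λ(𝒫_w(θ))` vanishes at `w ∣ p` -/

/-- **A Frobenius eigenvalue of a character `θ : Γ_K → GL₁(𝒪)` is a `p`-adic unit**: if every arithmetic Frobenius
at `w` has characteristic polynomial `X − a` on `θ`, then `‖a‖ = 1` (there is a prime of `K̄` above `w` and a
Frobenius at it; `a` is the entry `= det` of an invertible `1 × 1` matrix over `𝒪 = {‖x‖ ≤ 1}`).
[cite: SerreAbelianLadic1968, Ch. I §2.1, §2.3] -/
theorem norm_eq_one_of_hasFrobCharpolyAt (S : Set (PadicAlgCl p))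
    (θ : FramedGaloisRep K (padicCoeffIntegers S) 1) (w : HeightOneSpectrum (𝓞 K)) (a : padicCoeffIntegers S)
    (h : θ.HasFrobCharpolyAt w (X - C a)) : ‖(a : PadicAlgCl p)‖ = 1 := by
  obtain ⟨𝔓, h𝔓⟩ := HeightOneSpectrum.primesAbove_nonempty w
  obtain ⟨σ, hσ⟩ := HeightOneSpectrum.exists_isArithFrobAt_of_mem_primesAbove_holds h𝔓
  have hc := h 𝔓 h𝔓 σ hσ
  set M : Matrix (Fin 1) (Fin 1) (padicCoeffIntegers S) :=
    ((θ σ : GL (Fin 1) (padicCoeffIntegers S)) : Matrix (Fin 1) (Fin 1) (padicCoeffIntegers S)) with hM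
  have hchar : FramedRep.charpoly θ σ = X - C (M 0 0) := by
    change M.charpoly = _
    rw [Matrix.charpoly, Matrix.det_fin_one, Matrix.charmatrix_apply_eq]
  have ha : a = M 0 0 := by
    have e : X - C a = X - C (M 0 0) := hc.symm.trans hchar
    have := congrArg (fun q : (padicCoeffIntegers S)[X] ↦ (X - q).coeff 0) e
    simpa using this
  have hunit : IsUnit a := by
    rw [ha, ← Matrix.det_fin_one M, hM, ← Matrix.GeneralLinearGroup.val_det_apply]
    exact Units.isUnit _
  obtain ⟨u, hu⟩ := hunit
  have h1 : ‖((u : padicCoeffIntegers S) : PadicAlgCl p)‖ * ‖((↑u⁻¹ : padicCoeffIntegers S) : PadicAlgCl p)‖ = 1 := by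
    rw [← norm_mul, ← Subring.coe_mul, Units.mul_inv, Subring.coe_one, norm_one]
  have hle1 : ‖((u : padicCoeffIntegers S) : PadicAlgCl p)‖ ≤ 1 := (u : padicCoeffIntegers S).2.2
  have hle2 : ‖((↑u⁻¹ : padicCoeffIntegers S) : PadicAlgCl p)‖ ≤ 1 := (↑u⁻¹ : padicCoeffIntegers S).2.2
  rw [← hu]
  refine le_antisymm hle1 ?_
  calc (1 : ℝ) = ‖((u : padicCoeffIntegers S) : PadicAlgCl p)‖ * ‖((↑u⁻¹ : padicCoeffIntegers S) : PadicAlgCl p)‖ :=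
      h1.symm
    _ ≤ ‖((u : padicCoeffIntegers S) : PadicAlgCl p)‖ * 1 := mul_le_mul_of_nonneg_left hle2 (norm_nonneg _)
    _ = _ := mul_one _

/-- **`θ(Frob_w) ≢ Nw (mod 𝔭)` at every place `w ∋ p`**: the tree's `FrobActsAsNormAt S θ w` («`θ` unramified at `w`
and `‖θ(Frob_w) − Nw‖ < 1`») fails, since `‖θ(Frob_w)‖ = 1` while `‖Nw‖ < 1` (ultrametric inequality).
[cite: KellerYin2024, Lemma 1.1.1 (arXiv:2402.12781v2 TeX L455–462)] -/
theorem not_frobActsAsNormAt_of_mem (S : Set (PadicAlgCl p)) (θ : FramedGaloisRep K (padicCoeffIntegers S) 1)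
    {w : HeightOneSpectrum (𝓞 K)} (hw : ((p : ℕ) : 𝓞 K) ∈ w.asIdeal) : ¬ FrobActsAsNormAt S θ w := by
  rintro ⟨-, a, ha, hlt⟩
  have h1 := norm_eq_one_of_hasFrobCharpolyAt S θ w a ha
  have hN := norm_absNorm_lt_one (p := p) w hw
  have htri := IsUltrametricDist.norm_add_le_max ((a : PadicAlgCl p) - (w.asIdeal.absNorm : PadicAlgCl p))
    (w.asIdeal.absNorm : PadicAlgCl p)
  rw [sub_add_cancel, h1] at htri
  rcases le_max_iff.1 htri with h | h
  · exact absurd hlt (not_lt.2 h)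
  · exact absurd hN (not_lt.2 h)

/-- **`λ(𝒫_w(θ)) = 0` at every place `w ∋ p`**, for every character `θ : Γ_K → GL₁(𝒪)` and every tower `κ`.
(In print `𝒫_w(θ)` is only formed at `w ∤ p`; this is the typed term's value there.)
[cite: KellerYin2024, Lemma 1.1.1 (arXiv:2402.12781v2 TeX L455–462)] [cite: CastellaGrossiLeeSkinner2022, Lemma 1.1.1] -/
theorem charLocalLambda_eq_zero_of_mem (S : Set (PadicAlgCl p)) (κ : ZpExtension K p)
    (θ : FramedGaloisRep K (padicCoeffIntegers S) 1) {w : HeightOneSpectrum (𝓞 K)}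
    (hw : ((p : ℕ) : 𝓞 K) ∈ w.asIdeal) : charLocalLambda S κ θ w = 0 :=
  charLocalLambda_of_not_frobActsAsNormAt S κ θ w (not_frobActsAsNormAt_of_mem S θ hw)

/-- The sum of the character terms over any finite set of places equals the sum over its places prime to `p`.
[cite: CastellaGrossiLeeSkinner2022, Thm. 2.2.2 (the sum over w ∈ S) and Thm. 2.2.1 (𝓔_{φ,ψ})] -/
theorem sum_charLocalLambda_eq_sum_filter (S : Set (PadicAlgCl p)) (κ : ZpExtension K p)
    (θ : FramedGaloisRep K (padicCoeffIntegers S) 1) (Sf : Finset (HeightOneSpectrum (𝓞 K))) :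
    ∑ w ∈ Sf, charLocalLambda S κ θ w = ∑ w ∈ Sf.filter (fun w ↦ ((p : ℕ) : 𝓞 K) ∉ w.asIdeal), charLocalLambda S κ θ w := by
  rw [Finset.sum_filter]
  refine Finset.sum_congr rfl fun w _ ↦ ?_
  split_ifs with h
  · exact charLocalLambda_eq_zero_of_mem S κ θ h
  · rfl

/-! ## §4 The two sides of 24040 over `{w ∣ N}` are the tame sums over `{w ∣ N, w ∤ p}` -/

/-- **F-CHL-A5-2, kernel half.** For every curve `W/K`, tower `κ`, characters `θsub, θquot` and finite `Sf`:
the typed two-sided local sums of item 24040 over `Sf` coincide with the same sums over the places of `Sf` prime to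
`p` — so at `27 ∣ N` the typed frame carries exactly the printed (tame) factor set of CGLS Thm. 2.2.1/2.2.2.
[cite: CastellaGrossiLeeSkinner2022, Thm. 2.2.1 (𝓔_{φ,ψ} = ∏_{ℓ∣N₀N₋} 𝒫_w(φ) ∏_{ℓ∣N₀N₊} 𝒫_w(ψ)), Thm. 2.2.2] -/
theorem localSums_eq_localSums_filter (S : Set (PadicAlgCl p)) (κ : ZpExtension K p) (W : WeierstrassCurve K)
    (θsub θquot : FramedGaloisRep K (padicCoeffIntegers S) 1) (Sf : Finset (HeightOneSpectrum (𝓞 K))) (n m : ℕ) :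
    (n + ∑ w ∈ Sf, curveLocalLambda κ W w = m + ∑ w ∈ Sf, (charLocalLambda S κ θsub w + charLocalLambda S κ θquot w)) ↔
      (n + ∑ w ∈ Sf.filter (fun w ↦ ((p : ℕ) : 𝓞 K) ∉ w.asIdeal), curveLocalLambda κ W w =
        m + ∑ w ∈ Sf.filter (fun w ↦ ((p : ℕ) : 𝓞 K) ∉ w.asIdeal),
          (charLocalLambda S κ θsub w + charLocalLambda S κ θquot w)) := by
  rw [sum_curveLocalLambda_eq_sum_filter κ W Sf, Finset.sum_add_distrib, Finset.sum_add_distrib,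
    sum_charLocalLambda_eq_sum_filter S κ θsub Sf, sum_charLocalLambda_eq_sum_filter S κ θquot Sf]

end Summit.BirchSwinnertonDyer.BirchSwinnertonDyer.Theorems.EisensteinCongruenceCoreAtThreeLocalTermsAtP

end
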